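import Summits.FinalStateConjecture.FinalStateConjecture.Theorems.DissipativeFinalMotionsFinalEraGenericFlatOrientation
import Literature.Geometry.Lorentzian.TameGenericityLocal
import HarnessLib

/-!
# Route DissipativeFinalMotions — crux `FinalEraGeneric` (stmt-FinalStateConjecture-17642), line `registered`:
# the LOSSLESS RELATIVE CUT of the crux along tame weak cosmic censorship (skeleton rev 3, lead c2)

Tame codimension-1 genericity (`InitialDataSet.IsTameChristodoulouGeneric … 1`) is not closed under conjunction of properties, so
the pre-phase crux `FinalEraGeneric` (tame-generically: an MGHD exists and every MGHD has complete `𝓘⁺` and an oriented honest rev-2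
final era — `IsFinalEra₂` + (R) + (F) + (F₀)) does not split as "generic A ∧ generic B". It splits through the DOOR for a generic
hypothesis (`isTameChristodoulouGeneric_of_relative'`, TameGenericityDiagonal.lean) along the summit's shared generic leaf, TAME WEAK
COSMIC CENSORSHIP in MGHD form (verbatim the crux `PhaseMixingCapture.WeakCosmicCensorshipTame`, stmt-FinalStateConjecture-17269), and
avoidance is LOCAL in the parameter (`isTameChristodoulouGeneric_of_local`, TameGenericityLocal.lean). This file records, sorry-free
and by name, that the resulting cut is LOSSLESS:

* `tameCensorship_of_finalEraGeneric` — the crux implies tame weak cosmic censorship (monotonicity);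
* `eraAtCensoredData_of_finalEraGeneric` — the crux implies ERAS GENERIC AT CENSORED DATA: through every admissible censored datum
  (with an MGHD) one of whose MGHDs lacks an oriented honest era passes a tame injective immersed curve of admissible data (on some end)
  whose small members off `0` have MGHDs carrying oriented honest eras;
* `eraNearNakedData_of_finalEraGeneric` — the crux implies ERAS NEAR NAKED DATA: along a tame immersed injective curve of admissible
  data whose members off `0` are censored-with-MGHD while the base is not, there is such a curve through the base;
* `finalEraGeneric_of_relativeCut` — conversely the three statements give the crux (locality + the door by cases on censorship of the
  exceptional datum + (F₀) from `flatOrientation_of_isFinalEra₂`);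
* `finalEraGeneric_iff_relativeCut` — hence `FinalEraGeneric ↔ (tame WCC) ∧ (eras generic at censored data) ∧ (eras near naked data)`,
  unconditionally: in particular the crux does NOT hinge on the pointwise MGHD-existence fact of Choquet-Bruhat–Geroch.

The three right-hand statements are the registered stubs `stub_tameCensorship`, `stub_eraAtCensoredData`, `stub_eraNearNakedData` of the
crux's skeleton (Cruxes/FinalEraGeneric/Lines/birth.lean, rev 3); they are spelled out here (no definitions in a proof file).

References: Christodoulou, CQG 16 (1999) A23, p. A24; Ann. Math. 149 (1999) 183, p. 187 (genericity as positive codimension, lines in a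
fixed space); Dafermos–Luk arXiv:1710.01722, p. 8 (the final state conjecture); Dafermos–Rodnianski arXiv:0811.0354, §2.6.2, App. B.2.3.
-/

noncomputable section

-- `<Problem> = <Summit>` doubles the namespace component (tree-wide convention)
set_option linter.dupNamespace false

open Set Filter Topology Function
open scoped Manifold ContDiff Topology
open Literature.Geometry.Lorentzian

namespace Summit.FinalStateConjecture.FinalStateConjecture.Theorems.DissipativeFinalMotions.FinalEraGeneric

open Summit.FinalStateConjecture.FinalStateConjecture.Theses.DissipativeFinalMotions (FinalEraGeneric)

/-- **The crux implies tame weak cosmic censorship** (verbatim `PhaseMixingCapture.WeakCosmicCensorshipTame`, stmt-17269): forget the era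
(`IsTameChristodoulouGeneric.mono`). Christodoulou, CQG 16 (1999) A23, p. A24. [folklore] -/
theorem tameCensorship_of_finalEraGeneric : open scoped Manifold in Summit.FinalStateConjecture.FinalStateConjecture.Theses.DissipativeFinalMotions.FinalEraGeneric → ∀ (X : Type) [TopologicalSpace X] [ChartedSpace (EuclideanSpace ℝ (Fin 3)) X] [IsManifold (𝓡 3) ((⊤ : ℕ∞) : WithTop ℕ∞) X] [T2Space X] [SecondCountableTopology X] [ConnectedSpace X], Literature.Geometry.Lorentzian.InitialDataSet.IsTameChristodoulouGeneric (Literature.Geometry.Lorentzian.admissibleVacuumData X) (fun D ↦ (∃ 𝒟 : Literature.Geometry.Lorentzian.VacuumCauchyDevelopment D, 𝒟.IsMaximal) ∧ ∀ 𝒟 : Literature.Geometry.Lorentzian.VacuumCauchyDevelopment D, 𝒟.IsMaximal → Summit.FinalStateConjecture.HasCompleteNullInfinity 𝒟.toCauchyDevelopment) 1 := by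
  intro h X _ _ _ _ _ _
  exact InitialDataSet.IsTameChristodoulouGeneric.mono (h X) fun D _ hP ↦ ⟨hP.1, fun 𝒟 hmax ↦ (hP.2 𝒟 hmax).1⟩

/-- **The crux implies that eras are generic at censored data**: an admissible datum one of whose MGHDs lacks an oriented honest era is
exceptional for the crux's property, and the crux's own tame witness curve serves (its members off `0` satisfy the crux's property, a
fortiori they have MGHDs carrying oriented honest eras; `ε = 1`). Christodoulou, CQG 16 (1999) A23, p. A24. [folklore] -/
theorem eraAtCensoredData_of_finalEraGeneric (h : FinalEraGeneric) : ∀ (X : Type) [TopologicalSpace X] [ChartedSpace (EuclideanSpace ℝ (Fin 3)) X] [IsManifold (𝓡 3) ((⊤ : ℕ∞) : WithTop ℕ∞) X] [T2Space X] [SecondCountableTopology X] [ConnectedSpace X], ∀ d ∈ Literature.Geometry.Lorentzian.admissibleVacuumData X, (∃ 𝒟 : Literature.Geometry.Lorentzian.VacuumCauchyDevelopment d, 𝒟.IsMaximal) → (∀ 𝒟 : Literature.Geometry.Lorentzian.VacuumCauchyDevelopment d, 𝒟.IsMaximal → Summit.FinalStateConjecture.HasCompleteNullInfinity 𝒟.toCauchyDevelopment)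 → ¬ (∀ 𝒟 : Literature.Geometry.Lorentzian.VacuumCauchyDevelopment d, 𝒟.IsMaximal → Summit.FinalStateConjecture.HasCompleteNullInfinity 𝒟.toCauchyDevelopment ∧ ∃ (N : ℕ) (M a : Fin N → ℝ) (T δ V C₁ C₂ ρ₀ κ : ℝ) (ξ : Fin N → ℝ → EuclideanSpace ℝ (Fin 3)) (β : ℝ → ℝ) (U₀ : TopologicalSpace.Opens Literature.Geometry.Lorentzian.E4) (B₀ : Literature.Geometry.Lorentzian.ModelBackground) (B : Fin N → Literature.Geometry.Lorentzian.ModelBackground) (Ψ₀ : B₀.domain → 𝒟.carrier) (Ψ : (i : Fin N) → (B i).domain → 𝒟.carrier) (O : Set 𝒟.carrier), 𝒟.toCauchyDevelopment.IsFinalEra₂ N M a T δ V C₁ C₂ ρ₀ κ ξ β U₀ B₀ B Ψ₀ Ψ O ∧ Summit.FinalStateConjecture.RaysStayInClosure 𝒟.toCauchyDevelopment O ∧ (∀ i (ρ : ℝ), ∀ᶠ τ in Filter.atTop, ∀ x ∈ (B i).truncTimeSlab ρ τ, 𝒟.toSpacetime.timeOrientation.IsFutureDirected (mfderiv 𝓘(ℝ,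 Literature.Geometry.Lorentzian.E4) (𝓡 4) (Ψ i) x (Literature.Geometry.Lorentzian.Kerr.timeVector (M i) (a i) x.1)))) → ∃ (e' : Literature.Geometry.Lorentzian.AFEnd X) (F' : EuclideanSpace ℝ (Fin 1) → Literature.Geometry.Lorentzian.InitialDataSet (𝓡 3) X), Literature.Geometry.Lorentzian.InitialDataSet.IsTameDataFamily e' 1 F' ∧ F' 0 = d ∧ Function.Injective F' ∧ Literature.Geometry.Lorentzian.InitialDataSet.IsImmersedAtZero 1 F' ∧ (∀ c, F' c ∈ Literature.Geometry.Lorentzian.admissibleVacuumData X) ∧ ∃ ε > (0 : ℝ), ∀ c, c ≠ 0 → ‖c‖ < ε → (∃ 𝒟 : Literature.Geometry.Lorentzian.VacuumCauchyDevelopment (F' c), 𝒟.IsMaximal) ∧ ∀ 𝒟 : Literature.Geometry.Lorentzian.VacuumCauchyDevelopment (F' c), 𝒟.IsMaximal → Summit.FinalStateConjecture.HasCompleteNullInfinity 𝒟.toCauchyDevelopment ∧ ∃ (N : ℕ) (M a : Fin N → ℝ) (T δ V C₁ C₂ ρ₀ κ : ℝ) (ξ : Fin N → ℝ → EuclideanSpace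 ℝ (Fin 3)) (β : ℝ → ℝ) (U₀ : TopologicalSpace.Opens Literature.Geometry.Lorentzian.E4) (B₀ : Literature.Geometry.Lorentzian.ModelBackground) (B : Fin N → Literature.Geometry.Lorentzian.ModelBackground) (Ψ₀ : B₀.domain → 𝒟.carrier) (Ψ : (i : Fin N) → (B i).domain → 𝒟.carrier) (O : Set 𝒟.carrier), 𝒟.toCauchyDevelopment.IsFinalEra₂ N M a T δ V C₁ C₂ ρ₀ κ ξ β U₀ B₀ B Ψ₀ Ψ O ∧ Summit.FinalStateConjecture.RaysStayInClosure 𝒟.toCauchyDevelopment O ∧ (∀ i (ρ : ℝ), ∀ᶠ τ in Filter.atTop, ∀ x ∈ (B i).truncTimeSlab ρ τ, 𝒟.toSpacetime.timeOrientation.IsFutureDirected (mfderiv 𝓘(ℝ, Literature.Geometry.Lorentzian.E4) (𝓡 4) (Ψ i) x (Literature.Geometry.Lorentzian.Kerr.timeVector (M i) (a i) x.1))) := by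
  intro X _ _ _ _ _ _ d hd _ _ hdP
  obtain ⟨e, F, hF, himm, h0, hinj, h𝓓, hE⟩ := h X d ⟨hd, fun hP ↦ hdP fun 𝒟 hmax ↦
    let ⟨hscri, N, M, a, T, δ, V, C₁, C₂, ρ₀, κ, ξ, β, U₀, B₀, B, Ψ₀, Ψ, O, hera, hR, hF, _⟩ := hP.2 𝒟 hmax
    ⟨hscri, N, M, a, T, δ, V, C₁, C₂, ρ₀, κ, ξ, β, U₀, B₀, B, Ψ₀, Ψ, O, hera, hR, hF⟩⟩
  refine ⟨e, F, hF, h0, hinj, himm, h𝓓, 1, one_pos, fun c hc _ ↦ ?_⟩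
  have hP : _ := Classical.not_not.mp fun hn ↦ hE c hc ⟨h𝓓 c, hn⟩
  refine ⟨hP.1, fun 𝒟 hmax ↦ ?_⟩
  obtain ⟨hscri, N, M, a, T, δ, V, C₁, C₂, ρ₀, κ, ξ, β, U₀, B₀, B, Ψ₀, Ψ, O, hera, hR, hF, -⟩ := hP.2 𝒟 hmax
  exact ⟨hscri, N, M, a, T, δ, V, C₁, C₂, ρ₀, κ, ξ, β, U₀, B₀, B, Ψ₀, Ψ, O, hera, hR, hF⟩

/-- **The crux implies that eras exist near naked data**: a datum which is not censored-with-MGHD is exceptional for the crux's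
property; the crux's witness curve through it (on whatever end) serves (`ε = 1`). Christodoulou, CQG 16 (1999) A23, p. A24. [folklore] -/
theorem eraNearNakedData_of_finalEraGeneric (h : FinalEraGeneric) : ∀ (X : Type) [TopologicalSpace X] [ChartedSpace (EuclideanSpace ℝ (Fin 3)) X] [IsManifold (𝓡 3) ((⊤ : ℕ∞) : WithTop ℕ∞) X] [T2Space X] [SecondCountableTopology X] [ConnectedSpace X] (e : Literature.Geometry.Lorentzian.AFEnd X) (F : EuclideanSpace ℝ (Fin 1) → Literature.Geometry.Lorentzian.InitialDataSet (𝓡 3) X), Literature.Geometry.Lorentzian.InitialDataSet.IsTameDataFamily e 1 F → Literature.Geometry.Lorentzian.InitialDataSet.IsImmersedAtZero 1 F → Function.Injective F → (∀ c, F c ∈ Literature.Geometry.Lorentzian.admissibleVacuumData X) → (∀ c ≠ 0, (∃ 𝒟 : Literature.Geometry.Lorentzian.VacuumCauchyDevelopment (F c), 𝒟.IsMaximal) ∧ ∀ 𝒟 : Literature.Geometry.Lorentzian.VacuumCauchyDevelopment (F c), 𝒟.IsMaximal → Summit.FinalStateConjecture.HasCompleteNullInfinity 𝒟.toCauchyDevelopment)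 → ¬ ((∃ 𝒟 : Literature.Geometry.Lorentzian.VacuumCauchyDevelopment (F 0), 𝒟.IsMaximal) ∧ ∀ 𝒟 : Literature.Geometry.Lorentzian.VacuumCauchyDevelopment (F 0), 𝒟.IsMaximal → Summit.FinalStateConjecture.HasCompleteNullInfinity 𝒟.toCauchyDevelopment) → ∃ (e' : Literature.Geometry.Lorentzian.AFEnd X) (F' : EuclideanSpace ℝ (Fin 1) → Literature.Geometry.Lorentzian.InitialDataSet (𝓡 3) X), Literature.Geometry.Lorentzian.InitialDataSet.IsTameDataFamily e' 1 F' ∧ F' 0 = F 0 ∧ Function.Injective F' ∧ Literature.Geometry.Lorentzian.InitialDataSet.IsImmersedAtZero 1 F' ∧ (∀ c, F' c ∈ Literature.Geometry.Lorentzian.admissibleVacuumData X) ∧ ∃ ε > (0 : ℝ), ∀ c, c ≠ 0 → ‖c‖ < ε → (∃ 𝒟 : Literature.Geometry.Lorentzian.VacuumCauchyDevelopment (F' c), 𝒟.IsMaximal) ∧ ∀ 𝒟 : Literature.Geometry.Lorentzian.VacuumCauchyDevelopment (F' c), 𝒟.IsMaximal → Summit.FinalStateConjecture.HasCompleteNullInfinity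 𝒟.toCauchyDevelopment ∧ ∃ (N : ℕ) (M a : Fin N → ℝ) (T δ V C₁ C₂ ρ₀ κ : ℝ) (ξ : Fin N → ℝ → EuclideanSpace ℝ (Fin 3)) (β : ℝ → ℝ) (U₀ : TopologicalSpace.Opens Literature.Geometry.Lorentzian.E4) (B₀ : Literature.Geometry.Lorentzian.ModelBackground) (B : Fin N → Literature.Geometry.Lorentzian.ModelBackground) (Ψ₀ : B₀.domain → 𝒟.carrier) (Ψ : (i : Fin N) → (B i).domain → 𝒟.carrier) (O : Set 𝒟.carrier), 𝒟.toCauchyDevelopment.IsFinalEra₂ N M a T δ V C₁ C₂ ρ₀ κ ξ β U₀ B₀ B Ψ₀ Ψ O ∧ Summit.FinalStateConjecture.RaysStayInClosure 𝒟.toCauchyDevelopment O ∧ (∀ i (ρ : ℝ), ∀ᶠ τ in Filter.atTop, ∀ x ∈ (B i).truncTimeSlab ρ τ, 𝒟.toSpacetime.timeOrientation.IsFutureDirected (mfderiv 𝓘(ℝ, Literature.Geometry.Lorentzian.E4) (𝓡 4) (Ψ i) x (Literature.Geometry.Lorentzian.Kerr.timeVector (M i) (a i) x.1))) := by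
  intro X _ _ _ _ _ _ e F _ _ _ h𝓓F _ hQ
  obtain ⟨e', F', hF', himm', h0', hinj', h𝓓', hE'⟩ :=
    h X (F 0) ⟨h𝓓F 0, fun hP ↦ hQ ⟨hP.1, fun 𝒟 hmax ↦ (hP.2 𝒟 hmax).1⟩⟩
  refine ⟨e', F', hF', h0', hinj', himm', h𝓓', 1, one_pos, fun c hc _ ↦ ?_⟩
  have hP : _ := Classical.not_not.mp fun hn ↦ hE' c hc ⟨h𝓓' c, hn⟩
  refine ⟨hP.1, fun 𝒟 hmax ↦ ?_⟩
  obtain ⟨hscri, N, M, a, T, δ, V, C₁, C₂, ρ₀, κ, ξ, β, U₀, B₀, B, Ψ₀, Ψ, O, hera, hR, hF, -⟩ := hP.2 𝒟 hmax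
  exact ⟨hscri, N, M, a, T, δ, V, C₁, C₂, ρ₀, κ, ξ, β, U₀, B₀, B, Ψ₀, Ψ, O, hera, hR, hF⟩

/-- **The crux from the relative cut.** Tame weak cosmic censorship, eras generic at censored data and eras near naked data give
`FinalEraGeneric`: avoidance is local in the parameter (`isTameChristodoulouGeneric_of_local`); through an exceptional admissible datum
pass the curve of the second hypothesis if the datum is censored with an MGHD, and otherwise the curve of the third hypothesis along the
escaping curve that tame censorship provides (whose members off `0` are censored-with-MGHD because they are not exceptional for it) —
the door `isTameChristodoulouGeneric_of_relative'` with the base datum's exceptionality kept —; pointwise, (F₀) is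
`flatOrientation_of_isFinalEra₂`. Christodoulou, CQG 16 (1999) A23, p. A24; Dafermos–Luk arXiv:1710.01722, p. 8. [folklore] -/
theorem finalEraGeneric_of_relativeCut (h₂ : ∀ (X : Type) [TopologicalSpace X] [ChartedSpace (EuclideanSpace ℝ (Fin 3)) X] [IsManifold (𝓡 3) ((⊤ : ℕ∞) : WithTop ℕ∞) X] [T2Space X] [SecondCountableTopology X] [ConnectedSpace X], Literature.Geometry.Lorentzian.InitialDataSet.IsTameChristodoulouGeneric (Literature.Geometry.Lorentzian.admissibleVacuumData X) (fun D ↦ (∃ 𝒟 : Literature.Geometry.Lorentzian.VacuumCauchyDevelopment D, 𝒟.IsMaximal) ∧ ∀ 𝒟 : Literature.Geometry.Lorentzian.VacuumCauchyDevelopment D, 𝒟.IsMaximal → Summit.FinalStateConjecture.HasCompleteNullInfinity 𝒟.toCauchyDevelopment) 1) (h₃ : ∀ (X : Type) [TopologicalSpace X] [ChartedSpace (EuclideanSpace ℝ (Fin 3)) X] [IsManifold (𝓡 3) ((⊤ : ℕ∞) : WithTop ℕ∞) X] [T2Space X] [SecondCountableTopology X] [ConnectedSpace X], ∀ d ∈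 Literature.Geometry.Lorentzian.admissibleVacuumData X, (∃ 𝒟 : Literature.Geometry.Lorentzian.VacuumCauchyDevelopment d, 𝒟.IsMaximal) → (∀ 𝒟 : Literature.Geometry.Lorentzian.VacuumCauchyDevelopment d, 𝒟.IsMaximal → Summit.FinalStateConjecture.HasCompleteNullInfinity 𝒟.toCauchyDevelopment) → ¬ (∀ 𝒟 : Literature.Geometry.Lorentzian.VacuumCauchyDevelopment d, 𝒟.IsMaximal → Summit.FinalStateConjecture.HasCompleteNullInfinity 𝒟.toCauchyDevelopment ∧ ∃ (N : ℕ) (M a : Fin N → ℝ) (T δ V C₁ C₂ ρ₀ κ : ℝ) (ξ : Fin N → ℝ → EuclideanSpace ℝ (Fin 3)) (β : ℝ → ℝ) (U₀ : TopologicalSpace.Opens Literature.Geometry.Lorentzian.E4) (B₀ : Literature.Geometry.Lorentzian.ModelBackground) (B : Fin N → Literature.Geometry.Lorentzian.ModelBackground) (Ψ₀ : B₀.domain → 𝒟.carrier) (Ψ : (i : Fin N) → (B i).domain → 𝒟.carrier) (O : Set 𝒟.carrier), 𝒟.toCauchyDevelopment.IsFinalEra₂ N M a T δ V C₁ C₂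 ρ₀ κ ξ β U₀ B₀ B Ψ₀ Ψ O ∧ Summit.FinalStateConjecture.RaysStayInClosure 𝒟.toCauchyDevelopment O ∧ (∀ i (ρ : ℝ), ∀ᶠ τ in Filter.atTop, ∀ x ∈ (B i).truncTimeSlab ρ τ, 𝒟.toSpacetime.timeOrientation.IsFutureDirected (mfderiv 𝓘(ℝ, Literature.Geometry.Lorentzian.E4) (𝓡 4) (Ψ i) x (Literature.Geometry.Lorentzian.Kerr.timeVector (M i) (a i) x.1)))) → ∃ (e' : Literature.Geometry.Lorentzian.AFEnd X) (F' : EuclideanSpace ℝ (Fin 1) → Literature.Geometry.Lorentzian.InitialDataSet (𝓡 3) X), Literature.Geometry.Lorentzian.InitialDataSet.IsTameDataFamily e' 1 F' ∧ F' 0 = d ∧ Function.Injective F' ∧ Literature.Geometry.Lorentzian.InitialDataSet.IsImmersedAtZero 1 F' ∧ (∀ c, F' c ∈ Literature.Geometry.Lorentzian.admissibleVacuumData X) ∧ ∃ ε > (0 : ℝ), ∀ c, c ≠ 0 → ‖c‖ < ε → (∃ 𝒟 : Literature.Geometry.Lorentzian.VacuumCauchyDevelopment (F' c), 𝒟.IsMaximal)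 ∧ ∀ 𝒟 : Literature.Geometry.Lorentzian.VacuumCauchyDevelopment (F' c), 𝒟.IsMaximal → Summit.FinalStateConjecture.HasCompleteNullInfinity 𝒟.toCauchyDevelopment ∧ ∃ (N : ℕ) (M a : Fin N → ℝ) (T δ V C₁ C₂ ρ₀ κ : ℝ) (ξ : Fin N → ℝ → EuclideanSpace ℝ (Fin 3)) (β : ℝ → ℝ) (U₀ : TopologicalSpace.Opens Literature.Geometry.Lorentzian.E4) (B₀ : Literature.Geometry.Lorentzian.ModelBackground) (B : Fin N → Literature.Geometry.Lorentzian.ModelBackground) (Ψ₀ : B₀.domain → 𝒟.carrier) (Ψ : (i : Fin N) → (B i).domain → 𝒟.carrier) (O : Set 𝒟.carrier), 𝒟.toCauchyDevelopment.IsFinalEra₂ N M a T δ V C₁ C₂ ρ₀ κ ξ β U₀ B₀ B Ψ₀ Ψ O ∧ Summit.FinalStateConjecture.RaysStayInClosure 𝒟.toCauchyDevelopment O ∧ (∀ i (ρ : ℝ), ∀ᶠ τ in Filter.atTop, ∀ x ∈ (B i).truncTimeSlab ρ τ, 𝒟.toSpacetime.timeOrientation.IsFutureDirected (mfderiv 𝓘(ℝ,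 Literature.Geometry.Lorentzian.E4) (𝓡 4) (Ψ i) x (Literature.Geometry.Lorentzian.Kerr.timeVector (M i) (a i) x.1)))) (h₄ : ∀ (X : Type) [TopologicalSpace X] [ChartedSpace (EuclideanSpace ℝ (Fin 3)) X] [IsManifold (𝓡 3) ((⊤ : ℕ∞) : WithTop ℕ∞) X] [T2Space X] [SecondCountableTopology X] [ConnectedSpace X] (e : Literature.Geometry.Lorentzian.AFEnd X) (F : EuclideanSpace ℝ (Fin 1) → Literature.Geometry.Lorentzian.InitialDataSet (𝓡 3) X), Literature.Geometry.Lorentzian.InitialDataSet.IsTameDataFamily e 1 F → Literature.Geometry.Lorentzian.InitialDataSet.IsImmersedAtZero 1 F → Function.Injective F → (∀ c, F c ∈ Literature.Geometry.Lorentzian.admissibleVacuumData X) → (∀ c ≠ 0, (∃ 𝒟 : Literature.Geometry.Lorentzian.VacuumCauchyDevelopment (F c), 𝒟.IsMaximal) ∧ ∀ 𝒟 : Literature.Geometry.Lorentzian.VacuumCauchyDevelopment (F c), 𝒟.IsMaximal → Summit.FinalStateConjecture.HasCompleteNullInfinity 𝒟.toCauchyDevelopment) → ¬ ((∃ 𝒟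 : Literature.Geometry.Lorentzian.VacuumCauchyDevelopment (F 0), 𝒟.IsMaximal) ∧ ∀ 𝒟 : Literature.Geometry.Lorentzian.VacuumCauchyDevelopment (F 0), 𝒟.IsMaximal → Summit.FinalStateConjecture.HasCompleteNullInfinity 𝒟.toCauchyDevelopment) → ∃ (e' : Literature.Geometry.Lorentzian.AFEnd X) (F' : EuclideanSpace ℝ (Fin 1) → Literature.Geometry.Lorentzian.InitialDataSet (𝓡 3) X), Literature.Geometry.Lorentzian.InitialDataSet.IsTameDataFamily e' 1 F' ∧ F' 0 = F 0 ∧ Function.Injective F' ∧ Literature.Geometry.Lorentzian.InitialDataSet.IsImmersedAtZero 1 F' ∧ (∀ c, F' c ∈ Literature.Geometry.Lorentzian.admissibleVacuumData X) ∧ ∃ ε > (0 : ℝ), ∀ c, c ≠ 0 → ‖c‖ < ε → (∃ 𝒟 : Literature.Geometry.Lorentzian.VacuumCauchyDevelopment (F' c), 𝒟.IsMaximal) ∧ ∀ 𝒟 : Literature.Geometry.Lorentzian.VacuumCauchyDevelopment (F' c), 𝒟.IsMaximal → Summit.FinalStateConjecture.HasCompleteNullInfinity 𝒟.toCauchyDevelopment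 ∧ ∃ (N : ℕ) (M a : Fin N → ℝ) (T δ V C₁ C₂ ρ₀ κ : ℝ) (ξ : Fin N → ℝ → EuclideanSpace ℝ (Fin 3)) (β : ℝ → ℝ) (U₀ : TopologicalSpace.Opens Literature.Geometry.Lorentzian.E4) (B₀ : Literature.Geometry.Lorentzian.ModelBackground) (B : Fin N → Literature.Geometry.Lorentzian.ModelBackground) (Ψ₀ : B₀.domain → 𝒟.carrier) (Ψ : (i : Fin N) → (B i).domain → 𝒟.carrier) (O : Set 𝒟.carrier), 𝒟.toCauchyDevelopment.IsFinalEra₂ N M a T δ V C₁ C₂ ρ₀ κ ξ β U₀ B₀ B Ψ₀ Ψ O ∧ Summit.FinalStateConjecture.RaysStayInClosure 𝒟.toCauchyDevelopment O ∧ (∀ i (ρ : ℝ), ∀ᶠ τ in Filter.atTop, ∀ x ∈ (B i).truncTimeSlab ρ τ, 𝒟.toSpacetime.timeOrientation.IsFutureDirected (mfderiv 𝓘(ℝ, Literature.Geometry.Lorentzian.E4) (𝓡 4) (Ψ i) x (Literature.Geometry.Lorentzian.Kerr.timeVector (M i) (a i) x.1)))) : FinalEraGeneric := by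
  intro X _ _ _ _ _ _
  refine InitialDataSet.isTameChristodoulouGeneric_of_local fun d hd hdP ↦ ?_
  by_cases hQ : (∃ 𝒟 : VacuumCauchyDevelopment d, 𝒟.IsMaximal) ∧
      ∀ 𝒟 : VacuumCauchyDevelopment d, 𝒟.IsMaximal → HasCompleteNullInfinity 𝒟.toCauchyDevelopment
  · -- censored base with an MGHD
    obtain ⟨e, F', hF', h0, hinj, himm, h𝓓, ε, hε, hP⟩ := h₃ X d hd hQ.1 hQ.2 fun hE ↦ hdP ⟨hQ.1, fun 𝒟 hmax ↦
      let ⟨hscri, N, M, a, T, δ, V, C₁, C₂, ρ₀, κ, ξ, β, U₀, B₀, B, Ψ₀, Ψ, O, hera, hR, hF⟩ := hE 𝒟 hmax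
      ⟨hscri, N, M, a, T, δ, V, C₁, C₂, ρ₀, κ, ξ, β, U₀, B₀, B, Ψ₀, Ψ, O, hera, hR, hF, flatOrientation_of_isFinalEra₂ hera⟩⟩
    refine ⟨e, F', hF', himm, h0, hinj, h𝓓, ε, hε, fun c hc hcε ↦ ⟨(hP c hc hcε).1, fun 𝒟 hmax ↦ ?_⟩⟩
    obtain ⟨hscri, N, M, a, T, δ, V, C₁, C₂, ρ₀, κ, ξ, β, U₀, B₀, B, Ψ₀, Ψ, O, hera, hR, hF⟩ := (hP c hc hcε).2 𝒟 hmax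
    exact ⟨hscri, N, M, a, T, δ, V, C₁, C₂, ρ₀, κ, ξ, β, U₀, B₀, B, Ψ₀, Ψ, O, hera, hR, hF, flatOrientation_of_isFinalEra₂ hera⟩
  · -- naked base (or no MGHD): the escaping curve of tame censorship, then the third hypothesis
    obtain ⟨e, F, hF, himm, h0, hinj, h𝓓F, hE⟩ := h₂ X d ⟨hd, hQ⟩
    have hcens : ∀ c ≠ 0, (∃ 𝒟 : VacuumCauchyDevelopment (F c), 𝒟.IsMaximal) ∧
        ∀ 𝒟 : VacuumCauchyDevelopment (F c), 𝒟.IsMaximal → HasCompleteNullInfinity 𝒟.toCauchyDevelopment := fun c hc ↦ by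
      by_contra hc'
      exact hE c hc ⟨h𝓓F c, hc'⟩
    subst h0
    obtain ⟨e', F', hF', h0', hinj', himm', h𝓓', ε, hε, hP'⟩ := h₄ X e F hF himm hinj h𝓓F hcens hQ
    refine ⟨e', F', hF', himm', h0', hinj', h𝓓', ε, hε, fun c hc hcε ↦ ⟨(hP' c hc hcε).1, fun 𝒟 hmax ↦ ?_⟩⟩
    obtain ⟨hscri, N, M, a, T, δ, V, C₁, C₂, ρ₀, κ, ξ, β, U₀, B₀, B, Ψ₀, Ψ, O, hera, hR, hF⟩ := (hP' c hc hcε).2 𝒟 hmax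
    exact ⟨hscri, N, M, a, T, δ, V, C₁, C₂, ρ₀, κ, ξ, β, U₀, B₀, B, Ψ₀, Ψ, O, hera, hR, hF, flatOrientation_of_isFinalEra₂ hera⟩

/-- **The lossless relative cut of `FinalEraGeneric` (unconditional equivalence).** The crux is equivalent to the conjunction of tame
weak cosmic censorship in MGHD form (stmt-17269), eras generic at censored data, and eras near naked data. Christodoulou, CQG 16 (1999)
A23, p. A24; Dafermos–Luk arXiv:1710.01722, p. 8. [folklore] -/
theorem finalEraGeneric_iff_relativeCut : open scoped Manifold in Summit.FinalStateConjecture.FinalStateConjecture.Theses.DissipativeFinalMotions.FinalEraGeneric ↔ (∀ (X : Type) [TopologicalSpace X] [ChartedSpace (EuclideanSpace ℝ (Fin 3)) X] [IsManifold (𝓡 3) ((⊤ : ℕ∞) : WithTop ℕ∞) X] [T2Space X] [SecondCountableTopology X] [ConnectedSpace X], Literature.Geometry.Lorentzian.InitialDataSet.IsTameChristodoulouGeneric (Literature.Geometry.Lorentzian.admissibleVacuumData X) (fun D ↦ (∃ 𝒟 : Literature.Geometry.Lorentzian.VacuumCauchyDevelopment D, 𝒟.IsMaximal) ∧ ∀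 𝒟 : Literature.Geometry.Lorentzian.VacuumCauchyDevelopment D, 𝒟.IsMaximal → Summit.FinalStateConjecture.HasCompleteNullInfinity 𝒟.toCauchyDevelopment) 1) ∧ (∀ (X : Type) [TopologicalSpace X] [ChartedSpace (EuclideanSpace ℝ (Fin 3)) X] [IsManifold (𝓡 3) ((⊤ : ℕ∞) : WithTop ℕ∞) X] [T2Space X] [SecondCountableTopology X] [ConnectedSpace X], ∀ d ∈ Literature.Geometry.Lorentzian.admissibleVacuumData X, (∃ 𝒟 : Literature.Geometry.Lorentzian.VacuumCauchyDevelopment d, 𝒟.IsMaximal) → (∀ 𝒟 : Literature.Geometry.Lorentzian.VacuumCauchyDevelopment d, 𝒟.IsMaximal → Summit.FinalStateConjecture.HasCompleteNullInfinity 𝒟.toCauchyDevelopment) → ¬ (∀ 𝒟 : Literature.Geometry.Lorentzian.VacuumCauchyDevelopment d, 𝒟.IsMaximal → Summit.FinalStateConjecture.HasCompleteNullInfinity 𝒟.toCauchyDevelopment ∧ ∃ (N : ℕ) (M a : Fin N → ℝ) (T δ V C₁ C₂ ρ₀ κ : ℝ) (ξ : Fin N → ℝ → EuclideanSpace ℝ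 (Fin 3)) (β : ℝ → ℝ) (U₀ : TopologicalSpace.Opens Literature.Geometry.Lorentzian.E4) (B₀ : Literature.Geometry.Lorentzian.ModelBackground) (B : Fin N → Literature.Geometry.Lorentzian.ModelBackground) (Ψ₀ : B₀.domain → 𝒟.carrier) (Ψ : (i : Fin N) → (B i).domain → 𝒟.carrier) (O : Set 𝒟.carrier), 𝒟.toCauchyDevelopment.IsFinalEra₂ N M a T δ V C₁ C₂ ρ₀ κ ξ β U₀ B₀ B Ψ₀ Ψ O ∧ Summit.FinalStateConjecture.RaysStayInClosure 𝒟.toCauchyDevelopment O ∧ (∀ i (ρ : ℝ), ∀ᶠ τ in Filter.atTop, ∀ x ∈ (B i).truncTimeSlab ρ τ, 𝒟.toSpacetime.timeOrientation.IsFutureDirected (mfderiv 𝓘(ℝ, Literature.Geometry.Lorentzian.E4) (𝓡 4) (Ψ i) x (Literature.Geometry.Lorentzian.Kerr.timeVector (M i) (a i) x.1)))) → ∃ (e' : Literature.Geometry.Lorentzian.AFEnd X) (F' : EuclideanSpace ℝ (Fin 1) → Literature.Geometry.Lorentzian.InitialDataSet (𝓡 3) X), Literature.Geometry.Lorentzian.InitialDataSet.IsTameDataFamily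 e' 1 F' ∧ F' 0 = d ∧ Function.Injective F' ∧ Literature.Geometry.Lorentzian.InitialDataSet.IsImmersedAtZero 1 F' ∧ (∀ c, F' c ∈ Literature.Geometry.Lorentzian.admissibleVacuumData X) ∧ ∃ ε > (0 : ℝ), ∀ c, c ≠ 0 → ‖c‖ < ε → (∃ 𝒟 : Literature.Geometry.Lorentzian.VacuumCauchyDevelopment (F' c), 𝒟.IsMaximal) ∧ ∀ 𝒟 : Literature.Geometry.Lorentzian.VacuumCauchyDevelopment (F' c), 𝒟.IsMaximal → Summit.FinalStateConjecture.HasCompleteNullInfinity 𝒟.toCauchyDevelopment ∧ ∃ (N : ℕ) (M a : Fin N → ℝ) (T δ V C₁ C₂ ρ₀ κ : ℝ) (ξ : Fin N → ℝ → EuclideanSpace ℝ (Fin 3)) (β : ℝ → ℝ) (U₀ : TopologicalSpace.Opens Literature.Geometry.Lorentzian.E4) (B₀ : Literature.Geometry.Lorentzian.ModelBackground) (B : Fin N → Literature.Geometry.Lorentzian.ModelBackground) (Ψ₀ : B₀.domain → 𝒟.carrier) (Ψ : (i : Fin N) → (B i).domain → 𝒟.carrier) (O : Set 𝒟.carrier),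 𝒟.toCauchyDevelopment.IsFinalEra₂ N M a T δ V C₁ C₂ ρ₀ κ ξ β U₀ B₀ B Ψ₀ Ψ O ∧ Summit.FinalStateConjecture.RaysStayInClosure 𝒟.toCauchyDevelopment O ∧ (∀ i (ρ : ℝ), ∀ᶠ τ in Filter.atTop, ∀ x ∈ (B i).truncTimeSlab ρ τ, 𝒟.toSpacetime.timeOrientation.IsFutureDirected (mfderiv 𝓘(ℝ, Literature.Geometry.Lorentzian.E4) (𝓡 4) (Ψ i) x (Literature.Geometry.Lorentzian.Kerr.timeVector (M i) (a i) x.1)))) ∧ (∀ (X : Type) [TopologicalSpace X] [ChartedSpace (EuclideanSpace ℝ (Fin 3)) X] [IsManifold (𝓡 3) ((⊤ : ℕ∞) : WithTop ℕ∞) X] [T2Space X] [SecondCountableTopology X] [ConnectedSpace X] (e : Literature.Geometry.Lorentzian.AFEnd X) (F : EuclideanSpace ℝ (Fin 1) → Literature.Geometry.Lorentzian.InitialDataSet (𝓡 3) X), Literature.Geometry.Lorentzian.InitialDataSet.IsTameDataFamily e 1 F → Literature.Geometry.Lorentzian.InitialDataSet.IsImmersedAtZero 1 F → Function.Injective F →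 (∀ c, F c ∈ Literature.Geometry.Lorentzian.admissibleVacuumData X) → (∀ c ≠ 0, (∃ 𝒟 : Literature.Geometry.Lorentzian.VacuumCauchyDevelopment (F c), 𝒟.IsMaximal) ∧ ∀ 𝒟 : Literature.Geometry.Lorentzian.VacuumCauchyDevelopment (F c), 𝒟.IsMaximal → Summit.FinalStateConjecture.HasCompleteNullInfinity 𝒟.toCauchyDevelopment) → ¬ ((∃ 𝒟 : Literature.Geometry.Lorentzian.VacuumCauchyDevelopment (F 0), 𝒟.IsMaximal) ∧ ∀ 𝒟 : Literature.Geometry.Lorentzian.VacuumCauchyDevelopment (F 0), 𝒟.IsMaximal → Summit.FinalStateConjecture.HasCompleteNullInfinity 𝒟.toCauchyDevelopment) → ∃ (e' : Literature.Geometry.Lorentzian.AFEnd X) (F' : EuclideanSpace ℝ (Fin 1) → Literature.Geometry.Lorentzian.InitialDataSet (𝓡 3) X), Literature.Geometry.Lorentzian.InitialDataSet.IsTameDataFamily e' 1 F' ∧ F' 0 = F 0 ∧ Function.Injective F' ∧ Literature.Geometry.Lorentzian.InitialDataSet.IsImmersedAtZero 1 F' ∧ (∀ c, F' c ∈ Literature.Geometry.Lorentzian.admissibleVacuumData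 X) ∧ ∃ ε > (0 : ℝ), ∀ c, c ≠ 0 → ‖c‖ < ε → (∃ 𝒟 : Literature.Geometry.Lorentzian.VacuumCauchyDevelopment (F' c), 𝒟.IsMaximal) ∧ ∀ 𝒟 : Literature.Geometry.Lorentzian.VacuumCauchyDevelopment (F' c), 𝒟.IsMaximal → Summit.FinalStateConjecture.HasCompleteNullInfinity 𝒟.toCauchyDevelopment ∧ ∃ (N : ℕ) (M a : Fin N → ℝ) (T δ V C₁ C₂ ρ₀ κ : ℝ) (ξ : Fin N → ℝ → EuclideanSpace ℝ (Fin 3)) (β : ℝ → ℝ) (U₀ : TopologicalSpace.Opens Literature.Geometry.Lorentzian.E4) (B₀ : Literature.Geometry.Lorentzian.ModelBackground) (B : Fin N → Literature.Geometry.Lorentzian.ModelBackground) (Ψ₀ : B₀.domain → 𝒟.carrier) (Ψ : (i : Fin N) → (B i).domain → 𝒟.carrier) (O : Set 𝒟.carrier), 𝒟.toCauchyDevelopment.IsFinalEra₂ N M a T δ V C₁ C₂ ρ₀ κ ξ β U₀ B₀ B Ψ₀ Ψ O ∧ Summit.FinalStateConjecture.RaysStayInClosure 𝒟.toCauchyDevelopment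 O ∧ (∀ i (ρ : ℝ), ∀ᶠ τ in Filter.atTop, ∀ x ∈ (B i).truncTimeSlab ρ τ, 𝒟.toSpacetime.timeOrientation.IsFutureDirected (mfderiv 𝓘(ℝ, Literature.Geometry.Lorentzian.E4) (𝓡 4) (Ψ i) x (Literature.Geometry.Lorentzian.Kerr.timeVector (M i) (a i) x.1)))) :=
  ⟨fun h ↦ ⟨tameCensorship_of_finalEraGeneric h, eraAtCensoredData_of_finalEraGeneric h, eraNearNakedData_of_finalEraGeneric h⟩,
    fun h ↦ finalEraGeneric_of_relativeCut h.1 h.2.1 h.2.2⟩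

end Summit.FinalStateConjecture.FinalStateConjecture.Theorems.DissipativeFinalMotions.FinalEraGeneric

end
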